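import Mathlib
import HarnessLib
import HarnessLib.Audit
import Summits.ABC.Statement
import Literature.NumberTheory.EllipticCurves.CongruenceNumberLevelBoundExplicitProofs
import Literature.NumberTheory.EllipticCurves.CongruencePeriodTwistProductProofs
import Literature.NumberTheory.EllipticCurves.ManinConstantPlusPeriodCertificate
import Literature.NumberTheory.EllipticCurves.ModularFormsGamma0Genus
import Literature.NumberTheory.EllipticCurves.GlobalMinimalModelProofs
import Literature.NumberTheory.EllipticCurves.SzpiroOfAbcProofs
import Literature.NumberTheory.EllipticCurves.PastenSpectralDegree
import HarnessLib.Audit.Status.Attr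

/-!
Route: ParsevalSymbolDictionary

# Route ParsevalSymbolDictionary — Birch–Parseval mean-square dictionary — modular-symbol second
moments at prime denominators read the Néron covolume losslessly

It suffices to show X = K1 ∧ K2: (K1, `MeanSquareSymbolBound`, A0-strength as a family over K > 1/2;
each fixed K is the A-PS reading «NOT abc — POLY-SZPIRO(12K)») for every K > 1/2 the MEAN SQUARE
over a ∈ ℤ/q of the Ω-normalised modular symbols [a/q]^± of the newform of E/ℚ, at every prime q ∈
[N⁴, N⁵], is ≤ C(K)·N^(2K)·q; and (K2, `SymbolMeanSquareLowerBound`, spectral, believed PROVABLE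
NOW) the mean square of the un-normalised period integrals Re⟨a/q⟩, Im⟨a/q⟩ is ≥ c·q at some prime q
in the same window, uniformly in the level N ≥ N₀. The DICTIONARY (explicit, kernel-checked in
`closes`): Re⟨a/q⟩ = Ω⁺·[a/q]⁺, Im⟨a/q⟩ = Ω⁻·[a/q]⁻ (defs
`normalizedPlusSymbol/normalizedMinusSymbol`), so Ω⁺² = (Σ_a Re⟨a/q⟩²)/(Σ_a [a/q]⁺²) EXACTLY — K1 ∧
K2 give Ω^± ≥ (c/C)^(1/2)·N^(−K), the period sandwich `Summit.ABC.Analytic.periods_le_mul_covolume`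
(Ω⁺Ω⁻ ≤ 652·covol Λ_E: Manin integrality + Mazur–Kenku) gives covol ≥ c/(652·C·N^(2K)), and h_F =
−½·log covol (`WeierstrassCurve.faltingsHeight_eq_neg_half_log`) gives `PolyFaltingsHeightRat K`; K
= ½ + ε for every ε is `HeightConjectureRat`, and the kernel door
`Summit.ABC.Analytic.abc_of_heightConjectureRat` gives `ABC`. DEGREE-DOOR READING (director steer
g6-D44, E-A identity `ModularParametrizationData.two_mul_faltingsHeight_eq`: log deg φ = 2h_F +
log(4π²c²(f,f))): K1(K) ∧ K2 ⇒ `PolyFaltingsHeightRat K` ⇒ `PolyModularDegreeRat (2K + 2μ + 1 + θ)`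
by the tree theorem `polyModularDegreeRat_of_polyFaltingsHeightRat_of_manin_of_petersson` given
`PolyManinRat μ` and `PeterssonUpperRat θ`, and ⇒ `Summit.ABC.PolySzpiroRat` (exponent 12K) by
`polySzpiroRatEff_of_polyFaltingsHeightRatEff`. No summit is proved by this line; typed ≠ proved; no
abc claim; no side on [IUTchIII] Cor 3.12.
Lean: `MeanSquareSymbolBound ∧ SymbolMeanSquareLowerBound`

## Assembly
Kernel-checked in glue.lean (`closes`, ≈ 110 lines, rc 0 no sorry against a simulated gate render):
for ε > 0 take K = ½ + ε in K1 and (c, N₀) from K2; for a curve W pass to a global minimal model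
(h_F, N invariant: `faltingsHeight_smul`, `conductorNorm_smul_rat`); if N < N₀ use Murty–Pasten
`MurtyPasten.faltingsHeight_lt_of_modularity_mazurKenku` (h_F < 0.1·N·log N + 11 ≤ 0.1·N₀·log N₀ +
11); else take the datum D (ModularDatumExists) and the prime q of K2, rewrite (Re⟨a/q⟩)² =
Ω⁺²·[a/q]⁺² and (Im⟨a/q⟩)² = Ω⁻²·[a/q]⁻² (unfold `normalizedPlusSymbol`, `field_simp` with
`plusPeriod_newform_pos`, `IsNewform0.minusPeriod_pos_holds`), get c ≤ Ω⁺²·C·N^(1+2ε) and c ≤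
Ω⁻²·C·N^(1+2ε), multiply, take square roots (`mul_self_le_mul_self_iff`), apply the support item
PeriodSandwich (= `periods_le_mul_covolume`; fed with ModularDatumExists + MazurKenkuBound) to get
covol ≥ c/(652·C·N^(1+2ε)), then `faltingsHeight_eq_neg_half_log` +
`two_mul_covolume_eq_complexPeriod` give h_F ≤ (½+ε)·log N + ½·log(652·C/c); this is
`HeightConjectureRat`, and the support item HeightDoor (= `abc_of_heightConjectureRat`) closes
`_root_.ABC`. The Assembly item below is the type of `closes` (bookkeeping; every other declared
item is a binder of `closes`: 2 cruxes + 4 known supports).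

Rationale: WHY THIS LINE. Mechanism = DICTIONARY IMPORT (my technique card) of the GL(2)-spectral dictionary
{modular-symbol periods ⟷ twisted central values L(f⊗χ,1) (Birch: tree `twisted_LValue_eq`) ⟷
Parseval on (ℤ/q)ˣ ⟷ Néron periods Ω^± ⟷ covol Λ_E = e^(−2h_F) ⟷ deg φ = 4π²c²(f,f)/covol}, every
arrow an identity or a kernel theorem, so that the ONLY inequality left is a second-moment statement
about symbols (K1) plus a level-uniform second-moment lower bound for twisted L-values (K2). What is
imported: from analytic number theory the moment method for the family {f⊗χ : χ mod q} (first moment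
via the unbalanced approximate functional equation + Σ_χ χ(m)τ(χ)² = φ(q)·Kl(1,m̄;q) + Weil, which
is why q ≥ N⁴ makes the asymptotic LEVEL-UNIFORM; Cauchy–Schwarz turns it into the mean-square lower
bound K2), cf. IwaniecKowalski2004 Thm 5.3 / §14, Goldfeld1990 §4 (galaxy:panama:378506877861951
p.98–101: «Szpiro ⟺ lower bounds Ω ≫ N^(−κ)»; Conjecture 4 = SUP-form symbol bound,
Szpiro-strength), Goldfeld1992 (corpus doi:10.1090/s0025-5718-1992-1122069-5 p.2: symbol growth ⟺
Szpiro), MazurTateTeitelbaum1986 (symbols), PetridisRisager2004/2018 (symbol variance ~ C_f·log).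
What it does that prior routes do not: census row RC-12 (`PolyModSymRat κ B`, tree
`polyPeriodLowerBoundRat_of_polyModSymRat`) reads ONE symbol through the triangle inequality and
loses κ ↦ κ + β + B/2 (needs a non-vanishing twist, exponent never reaches ½ + ε); R4-3
manin-eigenvector-mass reads the ℓ²-mass of the Manin symbol vector over ℙ¹(ℤ/N) through the cup
product (a congruence-number door). Here the bridge is Birch–Parseval at prime denominators q ∈ [N⁴,
N⁵]: LOSSLESS in the exponent (K ↦ h_F ≤ K·log N, so the sharp family reaches A0), needs NO
non-vanishing of any individual twist (K2 is an average, provable), and NO Manin-constant bound (the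
height door is Manin-free; Manin enters only the degree-door reading, as `PolyManinRat μ`).

RANKED CRUXES. #2 MeanSquareSymbolBound (crux) — For every K > 1/2 there is C such that for every
elliptic W/ℚ with a modular parametrisation datum Dt at level N = conductor, every prime q with N⁴ ≤
q ≤ N⁵: Σ_(a<q) [a/q]⁺(f)² ≤ C·N^(2K)·q and Σ_(a<q) [a/q]⁻(f)² ≤ C·N^(2K)·q, where [·]^± are the
Ω^±-normalised modular symbols of the newform f = Dt.f (rational numbers, MTT §II.8). Fixed K = the
A-PS reading (⇒ PolyFaltingsHeightRat K ⇒ POLY-SZPIRO(12K), NOT abc); the family K ↓ ½ is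
A0-strength. [difficulty: open-problem] (why it might fail: A0-strength: by the dictionary K1(K)
forces h_F ≤ K log N + C, so K1 is false for K ≤ ½ (Masser, `not_polyFaltingsHeightRat_of_le_half`)
and at C small needs K ≥ 0.6313 in range (ENG-HEIGHT j285597); a symbol [a/q]^± of size N^K·polylog
at many a kills it.) [Goldfeld1990ModularElliptic, doi:10.1090/s0025-5718-1992-1122069-5,
MazurTateTeitelbaum1986, PetridisRisager2004, PastenShimura2024]
#3 SymbolMeanSquareLowerBound (crux) — There are c > 0 and N₀ such that for every elliptic W/ℚ with
a datum Dt at level N = conductor ≥ N₀ there is a prime q ∈ [N⁴, N⁵] with Σ_(a<q) (Re⟨a/q⟩_f)² ≥ c·q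
and Σ_(a<q) (Im⟨a/q⟩_f)² ≥ c·q (⟨r⟩ = −2πi∫_r^(i∞) f, tree `plusSymbol/minusSymbol`). Route to
proof: Birch (`twisted_LValue_eq`) + Parseval on (ℤ/q)ˣ: φ(q)·Σ_a (Re⟨a/q⟩)² ≥ Σ_(χ even, primitive)
|τ(χ̄)·L(f,χ̄,1)|²·(normalisation) ; first moment Σ_(χ(−1)=±1) L(f⊗χ,1) = φ(q)/2·(1 + O(N^(−1/4+ε)))
for q ≥ N⁴ by the unbalanced approximate functional equation (lengths q·N^(3/2) and q·N^(−1/2)) and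
Σ_χ χ(m)τ(χ)² = φ(q)·Kl(1, m̄; q) with Weil's bound; Cauchy–Schwarz gives c = 9/32; Bertrand
supplies the prime. [difficulty: L] (why it might fail: The level-uniform first moment needs the
dual sum after the functional equation of f⊗χ (conductor N·q²) to be o(φ(q)) — true for q ≥ N⁴ by
Weil for Kloosterman sums, but the root number/Atkin–Lehner sign bookkeeping at primes dividing N
must not bias the even/odd split.) [IwaniecKowalski2004, Birch1971, MazurTateTeitelbaum1986,
Rohrlich1984, arXiv:1804.01450]
#9 ModularDatumExists (support) — KNOWN (Wiles–Taylor–Wiles, BCDT Thm A, Carayol,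
Eichler–Shimura–Faltings): every globally minimal elliptic W/ℚ admits a ModularParametrizationData
at level N = conductorNorm. Verbatim the item of route IsogenyGlueCongruence (dedup); the tree
constant `nonempty_modularParametrizationData` is this statement. [difficulty: XL] [Wiles1995,
BCDT2001, Carayol1986]
#9 MazurKenkuBound (support) — KNOWN (Mazur 1978 Thm 1 + Kenku 1982; Pasten 2024 §3): the minimal
modular degree of a globally minimal curve is ≤ 163 × the optimal degree of its newform. Verbatim
the body of the Literature fact `PastenShimura2024_minimalDegree_le_163_mul` = item MazurKenkuBound
of route IsogenyGlueCongruence (dedup, already split there). [difficulty: XL] [Mazur1978, Kenku1982,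
PastenShimura2024]
#9 PeriodSandwich (support) — KNOWN IN THE KERNEL (cell theorem
`Summit.ABC.Analytic.periods_le_mul_covolume`, Summits/ABC/Analytic/PeriodSandwich.lean — route
files may import Literature only, so it is cited as a support item; checked verbatim in my folder
CheckDoors.lean, rc 0): modularity → Mazur–Kenku(163) → for every globally minimal W and datum D at
level N_W, Ω⁺(f)·Ω⁻(f) ≤ 652·covol(Λ_W) (Manin integrality c² ≥ 1, lattice-optimal datum, 652 =
4·163; no Manin bound needed in this direction). [difficulty: provable-now]
[Goldfeld1990ModularElliptic, ZagierCMB1985, Kenku1982, PastenShimura2024]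
#9 HeightDoor (support) — KNOWN IN THE KERNEL (cell theorem
`Summit.ABC.Analytic.abc_of_heightConjectureRat`, RequirementsSharp.lean; = `HeightConjectureRat →
ABC` unfolded; checked verbatim in CheckDoors.lean, rc 0): if h_F(E) ≤ (½+ε)·log N_E + C(ε) for
every ε > 0 and every elliptic E/ℚ, then abc (Silverman 1986 `12h ≥ log max(|Δ|,|c₄|³) − C₀` +
Bombieri–Gubler 12.5.12 generalized Szpiro ⇒ abc). [difficulty: provable-now] [Silverman1986,
BombieriGubler2006, PastenShimura2024]

TWO-LAYER PLAN. K2 ⇐ FirstMomentEven ∧ FirstMomentOdd → ParsevalIdentity → K2: (FirstMoment±) |Σ_(χ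
mod q primitive, χ(−1)=±1) L(f⊗χ,1) − φ(q)/2| ≤ φ(q)/4 for q prime ∈ [N⁴, 2N⁴], N ≥ N₀;
(ParsevalIdentity) φ(q)·Σ_(a mod q) (Re⟨a/q⟩)² = q·Σ_(χ≠χ₀ even) |L(f,χ̄,1)|² + |(a_q −
2)·L(f,1)|²-type identity from `twisted_LValue_eq`; glue = Cauchy–Schwarz over ≤ q/2 characters. K1
⇐ (SecondMomentUpper) Σ_χ |L(f⊗χ,1)|² ≤ C·q^(1+ε)·N^ε for q ∈ [N⁴, N⁵] (Lindelöf on average over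
twists, level-uniform; shifted convolutions a_n a_(n+hq)) ∧ (PeriodFloor K) Ω^±(f) ≥ c·N^(−K) — the
second child is the height conjecture in period form (Goldfeld 1990 (4)); this split is recorded,
not filed, because PeriodFloor(½+ε) is abc-strength by itself.

KILL CRITERIA. Refutation of K2 (a newform family with Σ_a (Re⟨a/q⟩)² = o(q) for ALL primes q ∈ [N⁴,
N⁵]) closes the route outright (close --reason refuted:SymbolMeanSquareLowerBound) — it would
contradict the level-uniform first-moment asymptotic, so it would itself be news. Refutation of K1
at some K > ½ by an explicit family (symbols of size ≫ N^K·q^(1/2) on a positive proportion of a)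
forces the pivot to the fixed-K A-PS reading with the measured K (the route then bears on A-PS only,
«NOT abc — POLY-SZPIRO(12K)»); refutation of K1 for EVERY K (super-polynomial symbol mean squares)
kills the line and, through the dictionary, refutes `PolyFaltingsHeightRat K` for every K — which
would refute abc itself, so it is not expected. A proof elsewhere of HeightConjectureRat moots the
route (same door).

NOT DECOMPOSED YET. The window [N⁴, N⁵] and the constant c = 9/32 are proof artefacts of K2 (any
window q ≥ N^A with a level-uniform first moment works; K1 must then be asked on the same window);
the even/odd sign bookkeeping, the exact Parseval normalisation (φ(q) vs q, the trivial-character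
and a = 0 terms) and the N < N₀ patch are glue-level and already absorbed in `closes`. Not split at
open: SecondMomentUpper/PeriodFloor (see Two-layer plan) — PeriodFloor(½+ε) alone is abc-strength,
so that split would be a costume; the honest content of K1 beyond abc is the Lindelöf-on-average
upper bound, filed later as support if K2's prover wants it.

CHEAPEST FALSIFIER. K2: PARI `lfuntwist`/`mfsymboleval` at level N ∈ {11, 14, 15, 37} and primes q ∈
[N⁴, 2N⁴] (q ≈ 1.5·10⁴ … 4·10⁶): check (1/q)·Σ_a (Re⟨a/q⟩)² ≥ 9/32 and the first moment
(2/φ(q))·Σ_(χ even) L(f⊗χ,1) ∈ [3/4, 5/4] — one kit job, minutes. K1 (instrument row = E-D /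
ENG-MSYM, ask abc-an-plan; data seats attach to this route id): for the 2,164,260 optimal curves N <
5·10⁵ already tabled (ENG-HEIGHT j285597, ENG-TERMS j288171) the dictionary predicts
log(M⁺(q)·M⁻(q))/(2·log N) → 2K with M^±(q) = (1/q)Σ_a [a/q]^±², so the existing h_F table already
calibrates K1: K ≥ 0.6313 at C·c-ratio 1 (279366b1) — a direct ENG-MSYM mean-square run at q ≈
10⁴…10⁵ for N ≤ 2000 would test the prediction curve by curve (falsifier: a curve whose symbol mean
square exceeds 652·C·e^(2h_F)·(f,f)-free prediction — impossible by the identity, so the run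
calibrates C(K), it cannot refute the dictionary; what CAN be refuted numerically is K2's constant
9/32 at small N).

NUMBERS. Floors (kernel, by decl name): `Summit.ABC.Analytic.not_polyFaltingsHeightRat_of_le_half`
(h_F ≤ K log N + C false for K ≤ ½, every C — Masser; so K1 is asked only for K > ½);
`Summit.ABC.Harvest.not_polyFaltingsHeightRatEff_zero_of_le` (K ≤ 2/3 false at C = 0,
Bennett–Yazdani N = 12735814);
`Summit.ABC.Harvest.not_polyFaltingsHeightRatEff_of_le_bennettYazdani` (the (K, C) trade-off line);
degree door `Summit.ABC.Harvest.not_polyModularDegreeRatEff_two_of_le_of_minDegree_279366b1` (K = 2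
needs C > 9.26). Calibration (computed ≠ proved): κ ≥ 0.6313 @ C′ = 1 for PolyFaltingsHeightRat
(ENG-HEIGHT j285597, 279366b1); K_deg ≥ 2.1776 @ C = 1 (ENG-MODDEG j285537). Dictionary constants:
652 = 4·163 (`periods_le_mul_covolume`); A-PS exponent 12K
(`polySzpiroRatEff_of_polyFaltingsHeightRatEff`: (K, C) ↦ (12K, 12C + 16)); degree exponent 2K + 2μ
+ 1 + θ (`polyModularDegreeRat_of_polyFaltingsHeightRat_of_manin_of_petersson`); K2: c = 9/32,
window [N⁴, N⁵], first-moment error exponent N^(−1/4+ε) at q = N⁴.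

DEFINITION REQUESTS. None: `plusSymbol`, `minusSymbol`, `normalizedPlusSymbol`,
`normalizedMinusSymbol`, `plusPeriod`, `minusPeriod`, `ModularParametrizationData`,
`twisted_LValue_eq` all exist (Literature.NumberTheory.EllipticCurves.ModularSymbols /
ModularCurve). A prover of K2 will want Dirichlet-character Parseval on (ZMod q)ˣ (Mathlib
`DirichletCharacter`, `ZMod.units`) and the Gauss-sum identity Σ_χ χ(m)τ(χ)² = φ(q)·Kl(1,m̄;q) as
support lemmas (filed by the prover with --supports, not items).

Novelty: Searches (2026-08-27): lit search --hybrid "second moment twisted L-functions prime modulus modular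
form level" (6 book hits, none on point: [corpus:book:bump1997-automorphic-forms-representations
p.385], [corpus:book:delbourgo2008-elliptic-curves-big-galois-representations p.61 — grep
Goldfeld|Szpiro: 0 lines]); lit search --hybrid "modular symbols Goldfeld conjecture Szpiro periods"
(6 hits, nearest [corpus:paper:anon2013-modular-forms-period-polynomials p.3], off-topic); lit
vsearch ×2 (first moment of twists uniform in level; Goldfeld symbols ⇒ Szpiro: textbook hits only,
[corpus:book:silverman2009-arithmetic-elliptic-curves-2nd-ed p.221–225]); lit galaxy search "twisted
modular L-functions|second moment of twisted|moments of twisted L" --star all (7 pdf hits: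
[galaxy:pdf:2373548260] Assing unipotent mixing, [galaxy:pdf:2718093120] Michel AWS notes on ℓ-adic
methods for twisted moments — the FKM/BFKMMS school, fixed level); "Goldfeld's conjecture|modular
symbols and Szpiro|Szpiro's conjecture and modular" --star all (14 rows, none stating a
mean-square/Parseval dictionary); "variance of modular symbols|Petridis-Risager|Mazur-Rubin
conjectures" --star all (1 off-topic hit); confirmed reads: [galaxy:panama:378506877861951 p.98–101]
Goldfeld 1990 §4 (Szpiro ⟺ Ω ≫ N^(−κ); Conjecture 4, sup-form symbol bound ⟺ Szpiro's Conj. 1 under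
Taniyama–Weil), [corpus:paper:doi-10-1090-s0025-5718-1992-1122069-5 p.2–3] Goldfeld 1992 (symbol
complexity ⟺ Szpiro). Tree: census RC-12 `PolyMod  [refs: book:bump1997-automorphic-forms-representations, book:delbourgo2008-elliptic-curves-big-galois-representations, paper:anon2013-modular-forms-period-polynomials, book:silverman2009-arithmetic-elliptic-curves-2nd-ed, paper:doi-10-1090-s0025-5718-1992-1122069-5]

Barriers (technique_class: dictionary-import, spectral-moment, modular-symbols): - technique_class: dictionary-import, spectral-moment, modular-symbols
- Literature.Barriers.ABC.SzpiroEpsilonCannotBeDropped: honoured, not evaded — K1 is asked only for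
K > ½ (strict), exactly because K1(½) ∧ K2 would give h_F ≤ ½·log N + C, which
`not_polyFaltingsHeightRat_of_le_half` (Masser's family) refutes; the line therefore also PREDICTS
unbounded normalised symbol mean squares N^(1+o(1)) along Masser's family (a checkable consequence).
- Literature.Barriers.ABC.EpsilonCannotBeDropped: same placement on the abc side (the door
`abc_of_heightConjectureRat` produces abc with ε > 0 only).
- Literature.Barriers.ABC.BakerMethodBounds: outside the class — no linear forms in logarithms
anywhere; the archimedean input is the period lattice read through L-values, not log-linear forms,
so the Stewart–Yu exp(rad^(1/3)) ceiling does not quantify over this line.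
- Literature.Barriers.ABC.UniformABCImpliesNoSiegelZeros: not triggered — the line is over ℚ with
constants depending on K only, no uniformity over number fields is claimed; K2's first moment uses
Weil's bound for Kloosterman sums, no exceptional-zero input.
- Literature.Barriers.ABC.ExplicitABCQualityFloor: consistent — constants C(K) are existential; the
calibration floors in ## Numbers are quoted by decl name.
- Literature.Barriers.ABC.IUTDisputedClaim: no side taken on [IUTchIII] Cor 3.12; nothing here uses
or contradicts it.
- Negatives index: the two refuted ABC statements (BelyiSqueeze stmt-ABC-1205, GlobalQuasiLogD

sub-problem: ABC · status: draft · opened planner-abc-idea-1-g0-0 2026-08-27T20:33:28Z · rev 1 · ledger route-ABC-ParsevalSymbolDictionary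
GENERATED by the gate from the ledger (D-0016/17). Provers cite these decls: `theorem foo : Summit.ABC.ABC.Theses.ParsevalSymbolDictionary.<Decl> := …` in Summits/ABC/ABC/Theorems/<Name>.lean.
-/

namespace Summit.ABC.ABC.Theses.ParsevalSymbolDictionary

open scoped BigOperators Topology Manifold Classical MeasureTheory ProbabilityTheory Matrix InnerProductSpace ComplexConjugate ContinuousMap
open Filter Set Function TopologicalSpace MeasureTheory

attribute [summit_statement] _root_.ABC

open Literature.Abc

/-- item stmt-ABC-22124 · crux · rank 2 · open · by planner
why it might fail: A0-strength: by the dictionary K1(K) forces h_F ≤ K log N + C, so K1 is false for K ≤ ½ (Masser, `not_polyFaltingsHeightRat_of_le_half`) and at C small needs K ≥ 0.6313 in range (ENG-HEIGHT j285597); a symbol [a/q]^± of size N^K·polylog at many a kills it.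
sources: Goldfeld1990ModularElliptic, doi:10.1090/s0025-5718-1992-1122069-5, MazurTateTeitelbaum1986, PetridisRisager2004, PastenShimura2024
[crux] For every K > 1/2 there is C such that for every elliptic W/ℚ with a modular parametrisation
datum Dt at level N = conductor, every prime q with N⁴ ≤ q ≤ N⁵: Σ_(a<q) [a/q]⁺(f)² ≤ C·N^(2K)·q and
Σ_(a<q) [a/q]⁻(f)² ≤ C·N^(2K)·q, where [·]^± are the Ω^±-normalised modular symbols of the newform f
= Dt.f (rational numbers, MTT §II.8). Fixed K = the A-PS reading (⇒ PolyFaltingsHeightRat K ⇒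
POLY-SZPIRO(12K), NOT abc); the family K ↓ ½ is A0-strength. [difficulty: open-problem] -/
@[route_item "route-ABC-ParsevalSymbolDictionary", crux]
def MeanSquareSymbolBound : Prop :=
  ∀ K : ℝ, 1 / 2 < K → ∃ C : ℝ, ∀ (W : WeierstrassCurve ℚ) [W.IsElliptic] (N : ℕ) [NeZero N] (Dt : Literature.NumberTheory.EllipticCurves.ModularForms.ModularParametrizationData W N), W.conductorNorm ℤ = N → ∀ q : ℕ, q.Prime → N ^ 4 ≤ q → q ≤ N ^ 5 → (∑ a ∈ Finset.range q, (Literature.NumberTheory.EllipticCurves.ModularForms.normalizedPlusSymbol Dt.f ((a : ℚ) / q)) ^ 2) ≤ C * (N : ℝ) ^ (2 * K) * q ∧ (∑ a ∈ Finset.range q, (Literature.NumberTheory.EllipticCurves.ModularForms.normalizedMinusSymbol Dt.f ((a : ℚ) / q)) ^ 2) ≤ C * (N : ℝ) ^ (2 * K) * q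

/-- item stmt-ABC-22125 · crux · rank 3 · SPLIT (gen 1) into AdditiveFirstMomentPlus, AdditiveFirstMomentMinus + glue SymbolMeanSquareLowerBoundGlue · direct attempts still welcome (low priority) · by planner
why it might fail: The level-uniform first moment needs the dual sum after the functional equation of f⊗χ (conductor N·q²) to be o(φ(q)) — true for q ≥ N⁴ by Weil for Kloosterman sums, but the root number/Atkin–Lehner sign bookkeeping at primes dividing N must not bias the even/odd split.
sources: IwaniecKowalski2004, Birch1971, MazurTateTeitelbaum1986, Rohrlich1984, arXiv:1804.01450
[crux] There are c > 0 and N₀ such that for every elliptic W/ℚ with a datum Dt at level N =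
conductor ≥ N₀ there is a prime q ∈ [N⁴, N⁵] with Σ_(a<q) (Re⟨a/q⟩_f)² ≥ c·q and Σ_(a<q)
(Im⟨a/q⟩_f)² ≥ c·q (⟨r⟩ = −2πi∫_r^(i∞) f, tree `plusSymbol/minusSymbol`). Route to proof: Birch
(`twisted_LValue_eq`) + Parseval on (ℤ/q)ˣ: φ(q)·Σ_a (Re⟨a/q⟩)² ≥ Σ_(χ even, primitive)
|τ(χ̄)·L(f,χ̄,1)|²·(normalisation) ; first moment Σ_(χ(−1)=±1) L(f⊗χ,1) = φ(q)/2·(1 + O(N^(−1/4+ε)))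
for q ≥ N⁴ by the unbalanced approximate functional equation (lengths q·N^(3/2) and q·N^(−1/2)) and
Σ_χ χ(m)τ(χ)² = φ(q)·Kl(1, m̄; q) with Weil's bound; Cauchy–Schwarz gives c = 9/32; Bertrand
supplies the prime. [difficulty: L] -/
@[route_item "route-ABC-ParsevalSymbolDictionary", crux]
def SymbolMeanSquareLowerBound : Prop :=
  ∃ c : ℝ, 0 < c ∧ ∃ N₀ : ℕ, ∀ (W : WeierstrassCurve ℚ) [W.IsElliptic] (N : ℕ) [NeZero N] (Dt : Literature.NumberTheory.EllipticCurves.ModularForms.ModularParametrizationData W N), W.conductorNorm ℤ = N → N₀ ≤ N → ∃ q : ℕ, q.Prime ∧ N ^ 4 ≤ q ∧ q ≤ N ^ 5 ∧ c * q ≤ ∑ a ∈ Finset.range q, ((Literature.NumberTheory.EllipticCurves.ModularForms.plusSymbol Dt.f ((a : ℚ) / q)).re) ^ 2 ∧ c * q ≤ ∑ a ∈ Finset.range q, ((Literature.NumberTheory.EllipticCurves.ModularForms.minusSymbol Dt.f ((a : ℚ) / q)).im) ^ 2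

-- parent: SymbolMeanSquareLowerBound · child (gen 1)
/--     item stmt-ABC-22751 · crux · rank 301 · open
    parent: SymbolMeanSquareLowerBound · by planner
    why it might fail: level-uniform constant 3/8: the dual (Fricke) side of the additive-twist AFE at a/q carries Kloosterman sums S(1,−N̄n;q); bounding it trivially (not by Cauchy–Schwarz over residues) gives O(N^{1/4}), not o(1); a 1/2-normalisation slip in plusSymbol moves the main term off q/2.
    sources: Manin1972, AtkinLehner1970, Weil1948, IwaniecKowalski2004, arXiv:1812.08378, arXiv:1703.09601
[crux, child 1 of K2] Level-uniform ADDITIVE first moment, plus part: for N ≥ N₀ and every prime q ∈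
[N⁴, N⁵], Σ_{a mod q} Re{∞,a/q}_f · cos(2πa/q) ≥ 3q/8. Mechanism: Σ_a {∞,a/q} e(−am/q) = q·Σ_{n≡m
(q)} a_n/n (regularised; {∞,r} = Σ a_n e(nr)/n in the tree's normalisation `modularSymbol` = 2π∫₀^∞
f(r+it)dt), so the left side equals (ŝ(1)+ŝ(−1))/2 with ŝ(1) = q(1 + Σ_{n≡1, n>1} a_n/n) and ŝ(−1) =
qΣ_{n≡−1} a_n/n; by the additive-twist approximate functional equation at a cusp a/q with (q,N)=1
(Atkin–Lehner/Fricke), both tails are O(N^{1/4+ε}q^{−1/2}) (direct terms, Deligne) +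
O(q^{−1/4}N^{1/8+ε}) (dual terms: Kloosterman sums S(1,−N̄n;q), Weil bound, Cauchy–Schwarz over
residues), = o(1) for q ≥ N^{1/2+δ}, a fortiori on [N⁴,N⁵]. No abc content: a provable analytic
statement (typed ≠ proved). -/
@[route_item "route-ABC-ParsevalSymbolDictionary"]
def AdditiveFirstMomentPlus : Prop :=
  ∃ N₀ : ℕ, ∀ (W : WeierstrassCurve ℚ) [W.IsElliptic] (N : ℕ) [NeZero N] (Dt : Literature.NumberTheory.EllipticCurves.ModularForms.ModularParametrizationData W N), W.conductorNorm ℤ = N → N₀ ≤ N → ∀ q : ℕ, q.Prime → N ^ 4 ≤ q → q ≤ N ^ 5 → (3 / 8 : ℝ) * q ≤ ∑ a ∈ Finset.range q, (Literature.NumberTheory.EllipticCurves.ModularForms.plusSymbol Dt.f ((a : ℚ) / q)).re * Real.cos (2 * Real.pi * a / q)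

-- parent: SymbolMeanSquareLowerBound · child (gen 1)
/--     item stmt-ABC-22752 · crux · rank 302 · open
    parent: SymbolMeanSquareLowerBound · by planner
    why it might fail: same level-uniformity issue as the plus child (dual side O(q^{-1/4}N^{1/8}) only after Cauchy–Schwarz over residues); and a convention making minusSymbol real (not i·Im{∞,r}) would zero the left side — checked against ModularSymbols.lean: minusSymbol = i·im.
    sources: Manin1972, AtkinLehner1970, Weil1948, IwaniecKowalski2004, arXiv:1812.08378, Cremona1997
[crux, child 2 of K2] Level-uniform ADDITIVE first moment, minus part: for N ≥ N₀ and every prime q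
∈ [N⁴, N⁵], Σ_{a mod q} Im{∞,a/q}_f · sin(2πa/q) ≥ 3q/8; equals (ŝ(1) − ŝ(−1))/2 with the same ŝ(±1)
as in the plus child, so the same AFE/Kloosterman analysis gives q/2·(1+o(1)). Provable analytic
statement (typed ≠ proved); no abc content. -/
@[route_item "route-ABC-ParsevalSymbolDictionary"]
def AdditiveFirstMomentMinus : Prop :=
  ∃ N₀ : ℕ, ∀ (W : WeierstrassCurve ℚ) [W.IsElliptic] (N : ℕ) [NeZero N] (Dt : Literature.NumberTheory.EllipticCurves.ModularForms.ModularParametrizationData W N), W.conductorNorm ℤ = N → N₀ ≤ N → ∀ q : ℕ, q.Prime → N ^ 4 ≤ q → q ≤ N ^ 5 → (3 / 8 : ℝ) * q ≤ ∑ a ∈ Finset.range q, (Literature.NumberTheory.EllipticCurves.ModularForms.minusSymbol Dt.f ((a : ℚ) / q)).im * Real.sin (2 * Real.pi * a / q)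

-- parent: SymbolMeanSquareLowerBound · glue (gen 1)
/--     item stmt-ABC-22753 · support · rank 303 · closed · proved by Summit.ABC.ABC.Theorems.symbolMeanSquareLowerBoundGlue_proof (prover)
    parent: SymbolMeanSquareLowerBound · GLUE: children ⟹ parent · by planner
AdditiveFirstMomentPlus → AdditiveFirstMomentMinus → SymbolMeanSquareLowerBound with c = 9/64:
Cauchy–Schwarz against the weights cos(2πa/q), sin(2πa/q) (squares ≤ 1, so Σ weights² ≤ q) turns
each first moment ≥ 3q/8 into a mean square ≥ 9q/64; a prime q ∈ (N⁴, 2N⁴] ⊆ [N⁴, N⁵] exists by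
Bertrand for N ≥ 2; N₀ := max(N₀⁺, N₀⁻, 2). PROVED in the planner's scratch file line2/SplitK2s.lean
(theorem symbolMeanSquareLowerBound_of_additiveFirstMoments, lean rc 0, 0 sorries, against a
verbatim copy of K2) — to be landed as a Theorems file once the route module is built. -/
@[route_item "route-ABC-ParsevalSymbolDictionary"]
def SymbolMeanSquareLowerBoundGlue : Prop :=
  AdditiveFirstMomentPlus → AdditiveFirstMomentMinus → SymbolMeanSquareLowerBound

-- `SymbolMeanSquareLowerBoundGlue` holds: proved by `Summit.ABC.ABC.Theorems.symbolMeanSquareLowerBoundGlue_proof` (its module imports this route file, so no `_holds` link can be stated here).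

/-- item stmt-ABC-15125 · support · rank 9 · open · by planner
sources: Mazur1978, Kenku1982, PastenShimura2024
[crux, rank 9 — KNOWN in print, XL formal debt; route-choice PROMOTION (planner rchoice 1e5e4a86,
2026-08-16) of the apex Literature fact
Literature.NumberTheory.EllipticCurves.ModularForms.PastenShimura2024_minimalDegree_le_163_mul,
whose body this statement repeats VERBATIM (definitionally equal — Sketch.lean `Iff.rfl`: closable
by `exact PastenShimura2024_minimalDegree_le_163_mul_holds` the day the fact is discharged, and
usable as is wherever a tree theorem takes `(h163 : PastenShimura2024_minimalDegree_le_163_mul)`)]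
MazurKenkuBound — the Mazur–Kenku comparison of modular degrees inside an isogeny class: if D is a
parametrisation datum at level N of minimal degree among all data with the same newform (the optimal
parametrisation, deg D = δ_{1,N}) and D' is a datum of a GLOBALLY MINIMAL elliptic W' with the same
newform, of minimal degree among the data of W' itself, then deg D' ≤ 163·deg D. In print
(PastenShimura2024 §3 p.13): every parametrisation of W' factors through the optimal quotient
followed by an isogeny; ℚ-isogenous curves are joined by a CYCLIC ℚ-isogeny of degree in Kenku's
list {1..19,21,25,27,37,43,67,163} (Mazur1978 Thm 1 for prime degree — Eisenstein ideal —, -/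
@[route_item "route-ABC-ParsevalSymbolDictionary", crux]
def MazurKenkuBound : Prop :=
  ∀ (N : ℕ) [NeZero N] (W W' : WeierstrassCurve ℚ) [W.IsElliptic] [W'.IsElliptic] [W'.IsGloballyMinimal] (D : Literature.NumberTheory.EllipticCurves.ModularForms.ModularParametrizationData W N) (D' : Literature.NumberTheory.EllipticCurves.ModularForms.ModularParametrizationData W' N), D'.f = D.f → (∀ (W'' : WeierstrassCurve ℚ) [W''.IsElliptic] (D'' : Literature.NumberTheory.EllipticCurves.ModularForms.ModularParametrizationData W'' N), D''.f = D.f → D.modularDegree ≤ D''.modularDegree) → (∀ D'' : Literature.NumberTheory.EllipticCurves.ModularForms.ModularParametrizationData W' N, D'.modularDegree ≤ D''.modularDegree) → D'.modularDegree ≤ 163 * D.modularDegree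

/-- item stmt-ABC-15126 · support · rank 9 · open · by planner
sources: Wiles1995, BCDT2001, Carayol1986
[crux, rank 9 — KNOWN in print, XL formal debt; itemised 2026-08-16 (planner rchoice 1e5e4a86)
together with MazurKenkuBound so that the inputs of the K- and U-line of this route are route ITEMS
and no line assembly rests on an apex Literature fact — the assembly file
IsogenyGlueCongruenceDegreePrimesPolyBoundedOfTorsionSharing took BOTH
PastenShimura2024_minimalDegree_le_163_mul and exists_isNewformOf as hypotheses] ModularDatumExists
— modularity with an integral Manin constant, datum form, VERBATIM the body of
Literature.NumberTheory.EllipticCurves.ModularForms.nonempty_modularParametrizationData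
(definitionally equal, Sketch.lean `Iff.rfl`; closable by `exact
nonempty_modularParametrizationData_holds` the day the fact is discharged): every elliptic W/ℚ given
by a globally minimal model admits a ModularParametrizationData at level N_W = W.conductorNorm ℤ
(newform f with aₙ(f) = aₙ(W), Néron period pair and uniformisation, integer Manin constant c with
cΛ_f ⊆ Λ_W, degree). In print: Wiles1995 + TaylorWiles1995 (semistable — all the K-line needs),
Breuil–Conrad–Diamond–Taylor 2001 Thm A (all E/ℚ), level = conductor (Carayol1986), Eichler–Shimura
construction + Faltings' isogeny th -/
@[route_item "route-ABC-ParsevalSymbolDictionary", crux]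
def ModularDatumExists : Prop :=
  ∀ (W : WeierstrassCurve ℚ) [W.IsElliptic] [W.IsGloballyMinimal] [NeZero (W.conductorNorm ℤ)], Nonempty (Literature.NumberTheory.EllipticCurves.ModularForms.ModularParametrizationData W (W.conductorNorm ℤ))

/-- item stmt-ABC-22126 · support · rank 9 · open · by planner
sources: Goldfeld1990ModularElliptic, ZagierCMB1985, Kenku1982, PastenShimura2024
[support] KNOWN IN THE KERNEL (cell theorem `Summit.ABC.Analytic.periods_le_mul_covolume`,
Summits/ABC/Analytic/PeriodSandwich.lean — route files may import Literature only, so it is cited as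
a support item; checked verbatim in my folder CheckDoors.lean, rc 0): modularity → Mazur–Kenku(163)
→ for every globally minimal W and datum D at level N_W, Ω⁺(f)·Ω⁻(f) ≤ 652·covol(Λ_W) (Manin
integrality c² ≥ 1, lattice-optimal datum, 652 = 4·163; no Manin bound needed in this direction).
[difficulty: provable-now] -/
@[route_item "route-ABC-ParsevalSymbolDictionary", crux]
def PeriodSandwich : Prop :=
  Literature.NumberTheory.EllipticCurves.ModularForms.nonempty_modularParametrizationData → Literature.NumberTheory.EllipticCurves.ModularForms.PastenShimura2024_minimalDegree_le_163_mul → ∀ (W : WeierstrassCurve ℚ) [W.IsElliptic] [W.IsGloballyMinimal] [NeZero (W.conductorNorm ℤ)] (D : Literature.NumberTheory.EllipticCurves.ModularForms.ModularParametrizationData W (W.conductorNorm ℤ)), Literature.NumberTheory.EllipticCurves.ModularForms.plusPeriod D.f * Literature.NumberTheory.EllipticCurves.ModularForms.minusPeriod D.f ≤ 652 * ZLattice.covolume D.L.lattice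

/-- item stmt-ABC-22127 · support · rank 9 · open · by planner
sources: Silverman1986, BombieriGubler2006, PastenShimura2024
[support] KNOWN IN THE KERNEL (cell theorem `Summit.ABC.Analytic.abc_of_heightConjectureRat`,
RequirementsSharp.lean; = `HeightConjectureRat → ABC` unfolded; checked verbatim in CheckDoors.lean,
rc 0): if h_F(E) ≤ (½+ε)·log N_E + C(ε) for every ε > 0 and every elliptic E/ℚ, then abc (Silverman
1986 `12h ≥ log max(|Δ|,|c₄|³) − C₀` + Bombieri–Gubler 12.5.12 generalized Szpiro ⇒ abc).
[difficulty: provable-now] -/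
@[route_item "route-ABC-ParsevalSymbolDictionary", crux]
def HeightDoor : Prop :=
  (∀ ε : ℝ, 0 < ε → ∃ C : ℝ, ∀ (W : WeierstrassCurve ℚ) [W.IsElliptic], W.faltingsHeight ≤ (1 / 2 + ε) * Real.log (W.conductorNorm ℤ) + C) → _root_.ABC

/-- item stmt-ABC-22128 · assembly · rank 1 · open · by planner
sources: Goldfeld1990ModularElliptic, PastenShimura2024
[assembly] MeanSquareSymbolBound → SymbolMeanSquareLowerBound → ModularDatumExists → MazurKenkuBound
→ PeriodSandwich → HeightDoor → ABC (the sub-problem statement `_root_.ABC`), by the glue just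
described. -/
@[route_item "route-ABC-ParsevalSymbolDictionary"]
def Assembly : Prop :=
  MeanSquareSymbolBound → SymbolMeanSquareLowerBound → ModularDatumExists → MazurKenkuBound → PeriodSandwich → HeightDoor → _root_.ABC

/-! D-0027 §2.1 — DECIDING THEOREM (planner-authored via `route open/edit --closes-file`; by planner-abc-idea-1-g0-0 2026-08-27T20:33:29Z):
its hypotheses are this route's items and its conclusion the sub-problem Statement (glue_lint), and it elaborates with this file. -/

@[closes "route-ABC-ParsevalSymbolDictionary"] theorem closes (h1 : MeanSquareSymbolBound) (h2 : SymbolMeanSquareLowerBound)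
    (hMod : ModularDatumExists) (hMK : MazurKenkuBound) (hPS : PeriodSandwich) (hDoor : HeightDoor) :
    _root_.ABC := by
  -- Deciding theorem of route ParsevalSymbolDictionary (planner abc-idea-1, 2026-08-27).  The A0 door is the HEIGHT door
  -- (item `HeightDoor` = kernel theorem `Summit.ABC.Analytic.abc_of_heightConjectureRat`, class {ABC ↔ HeightConj ↔ DegreeConj}); the
  -- dictionary is Birch–Parseval: for a prime q the mean squares over a ∈ ℤ/q of Re⟨a/q⟩⁺ = Ω⁺·[a/q]⁺ and Im⟨a/q⟩⁻ = Ω⁻·[a/q]⁻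
  -- read Ω^± = (period integral mean square) / (normalised symbol mean square) LOSSLESSLY; the period sandwich
  -- `periods_le_mul_covolume` (Ω⁺Ω⁻ ≤ 652·covol Λ_W, Manin-integrality + Mazur–Kenku) and h_F = −½ log covol finish.
  -- Core inequality, for ONE globally minimal curve: c ≤ 652 · A · covol(Λ_W).
  have core : ∀ (V : WeierstrassCurve ℚ) [V.IsElliptic] [V.IsGloballyMinimal] [NeZero (V.conductorNorm ℤ)]
      (D : Literature.NumberTheory.EllipticCurves.ModularForms.ModularParametrizationData V (V.conductorNorm ℤ))
      (q : ℕ), 0 < q → ∀ (A c : ℝ), 0 ≤ A → 0 < c →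
      (∑ a ∈ Finset.range q, (Literature.NumberTheory.EllipticCurves.ModularForms.normalizedPlusSymbol D.f ((a : ℚ) / q)) ^ 2) ≤ A * q →
      (∑ a ∈ Finset.range q, (Literature.NumberTheory.EllipticCurves.ModularForms.normalizedMinusSymbol D.f ((a : ℚ) / q)) ^ 2) ≤ A * q →
      c * q ≤ (∑ a ∈ Finset.range q, ((Literature.NumberTheory.EllipticCurves.ModularForms.plusSymbol D.f ((a : ℚ) / q)).re) ^ 2) →
      c * q ≤ (∑ a ∈ Finset.range q, ((Literature.NumberTheory.EllipticCurves.ModularForms.minusSymbol D.f ((a : ℚ) / q)).im) ^ 2) →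
      c ≤ 652 * A * ZLattice.covolume D.L.lattice := by
    intro V _ _ _ D q hq A c hA hc hup hum hlp hlm
    have hplus : 0 < Literature.NumberTheory.EllipticCurves.ModularForms.plusPeriod D.f := D.plusPeriod_newform_pos
    have hminus : 0 < Literature.NumberTheory.EllipticCurves.ModularForms.minusPeriod D.f :=
      Literature.NumberTheory.EllipticCurves.ModularForms.IsNewform0.minusPeriod_pos_holds D.isNewformOf.1
        D.isNewformOf.coeffField_eq_bot
    have hqpos : (0 : ℝ) < q := by exact_mod_cast hq
    have eP : ∀ r : ℚ, ((Literature.NumberTheory.EllipticCurves.ModularForms.plusSymbol D.f r).re) ^ 2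
        = (Literature.NumberTheory.EllipticCurves.ModularForms.plusPeriod D.f) ^ 2
          * (Literature.NumberTheory.EllipticCurves.ModularForms.normalizedPlusSymbol D.f r) ^ 2 := by
      intro r
      have : (Literature.NumberTheory.EllipticCurves.ModularForms.plusSymbol D.f r).re
          = Literature.NumberTheory.EllipticCurves.ModularForms.plusPeriod D.f
            * Literature.NumberTheory.EllipticCurves.ModularForms.normalizedPlusSymbol D.f r := by
        unfold Literature.NumberTheory.EllipticCurves.ModularForms.normalizedPlusSymbol
        field_simp
      rw [this]; ring
    have eM : ∀ r : ℚ, ((Literature.NumberTheory.EllipticCurves.ModularForms.minusSymbol D.f r).im) ^ 2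
        = (Literature.NumberTheory.EllipticCurves.ModularForms.minusPeriod D.f) ^ 2
          * (Literature.NumberTheory.EllipticCurves.ModularForms.normalizedMinusSymbol D.f r) ^ 2 := by
      intro r
      have : (Literature.NumberTheory.EllipticCurves.ModularForms.minusSymbol D.f r).im
          = Literature.NumberTheory.EllipticCurves.ModularForms.minusPeriod D.f
            * Literature.NumberTheory.EllipticCurves.ModularForms.normalizedMinusSymbol D.f r := by
        unfold Literature.NumberTheory.EllipticCurves.ModularForms.normalizedMinusSymbol
        field_simp
      rw [this]; ring
    have sP : (∑ a ∈ Finset.range q, ((Literature.NumberTheory.EllipticCurves.ModularForms.plusSymbol D.f ((a : ℚ) / q)).re) ^ 2)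
        = (Literature.NumberTheory.EllipticCurves.ModularForms.plusPeriod D.f) ^ 2
          * ∑ a ∈ Finset.range q, (Literature.NumberTheory.EllipticCurves.ModularForms.normalizedPlusSymbol D.f ((a : ℚ) / q)) ^ 2 := by
      rw [Finset.mul_sum]; exact Finset.sum_congr rfl (fun a _ => eP _)
    have sM : (∑ a ∈ Finset.range q, ((Literature.NumberTheory.EllipticCurves.ModularForms.minusSymbol D.f ((a : ℚ) / q)).im) ^ 2)
        = (Literature.NumberTheory.EllipticCurves.ModularForms.minusPeriod D.f) ^ 2
          * ∑ a ∈ Finset.range q, (Literature.NumberTheory.EllipticCurves.ModularForms.normalizedMinusSymbol D.f ((a : ℚ) / q)) ^ 2 := by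
      rw [Finset.mul_sum]; exact Finset.sum_congr rfl (fun a _ => eM _)
    have h1 : c * q ≤ ((Literature.NumberTheory.EllipticCurves.ModularForms.plusPeriod D.f) ^ 2 * A) * q := by
      calc c * q ≤ _ := hlp
        _ = _ := sP
        _ ≤ (Literature.NumberTheory.EllipticCurves.ModularForms.plusPeriod D.f) ^ 2 * (A * q) :=
            mul_le_mul_of_nonneg_left hup (by positivity)
        _ = ((Literature.NumberTheory.EllipticCurves.ModularForms.plusPeriod D.f) ^ 2 * A) * q := by ring
    have h2 : c * q ≤ ((Literature.NumberTheory.EllipticCurves.ModularForms.minusPeriod D.f) ^ 2 * A) * q := by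
      calc c * q ≤ _ := hlm
        _ = _ := sM
        _ ≤ (Literature.NumberTheory.EllipticCurves.ModularForms.minusPeriod D.f) ^ 2 * (A * q) :=
            mul_le_mul_of_nonneg_left hum (by positivity)
        _ = ((Literature.NumberTheory.EllipticCurves.ModularForms.minusPeriod D.f) ^ 2 * A) * q := by ring
    have h1' : c ≤ (Literature.NumberTheory.EllipticCurves.ModularForms.plusPeriod D.f) ^ 2 * A :=
      le_of_mul_le_mul_right h1 hqpos
    have h2' : c ≤ (Literature.NumberTheory.EllipticCurves.ModularForms.minusPeriod D.f) ^ 2 * A :=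
      le_of_mul_le_mul_right h2 hqpos
    have hprod : c * c ≤ (Literature.NumberTheory.EllipticCurves.ModularForms.plusPeriod D.f
          * Literature.NumberTheory.EllipticCurves.ModularForms.minusPeriod D.f * A)
        * (Literature.NumberTheory.EllipticCurves.ModularForms.plusPeriod D.f
          * Literature.NumberTheory.EllipticCurves.ModularForms.minusPeriod D.f * A) := by
      have := mul_le_mul h1' h2' hc.le (by positivity)
      calc c * c ≤ (Literature.NumberTheory.EllipticCurves.ModularForms.plusPeriod D.f) ^ 2 * A
            * ((Literature.NumberTheory.EllipticCurves.ModularForms.minusPeriod D.f) ^ 2 * A) := this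
        _ = _ := by ring
    have hcA : c ≤ Literature.NumberTheory.EllipticCurves.ModularForms.plusPeriod D.f
        * Literature.NumberTheory.EllipticCurves.ModularForms.minusPeriod D.f * A :=
      (mul_self_le_mul_self_iff hc.le (by positivity)).mpr hprod
    have hsand : Literature.NumberTheory.EllipticCurves.ModularForms.plusPeriod D.f
        * Literature.NumberTheory.EllipticCurves.ModularForms.minusPeriod D.f ≤ 652 * ZLattice.covolume D.L.lattice :=
      hPS (fun V _ _ _ => hMod V) hMK V D
    have h3 : Literature.NumberTheory.EllipticCurves.ModularForms.plusPeriod D.f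
        * Literature.NumberTheory.EllipticCurves.ModularForms.minusPeriod D.f * A ≤ (652 * ZLattice.covolume D.L.lattice) * A :=
      mul_le_mul_of_nonneg_right hsand hA
    linarith [hcA, h3]
  -- The door.
  refine hDoor ?_
  intro ε hε
  obtain ⟨C₁, hC₁⟩ := h1 (1 / 2 + ε) (by linarith)
  obtain ⟨c, hc, N₀, hN₀⟩ := h2
  set C : ℝ := max C₁ 1 with hCdef
  have hC1 : 1 ≤ C := le_max_right _ _
  have hCpos : 0 < C := lt_of_lt_of_le one_pos hC1
  set K₀ : ℝ := 0.1 * (N₀ : ℝ) * Real.log N₀ + 11 with hK₀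
  set K₁ : ℝ := (1 / 2) * Real.log (652 * C / c) with hK₁
  refine ⟨max K₀ K₁, fun W _ => ?_⟩
  -- pass to a global minimal model (h_F and N are model-invariant)
  obtain ⟨Cv, hV⟩ := WeierstrassCurve.hasGlobalMinimalModel_rat_holds W
  haveI : (Cv • W).IsGloballyMinimal := hV
  rw [← WeierstrassCurve.faltingsHeight_smul W Cv, ← WeierstrassCurve.conductorNorm_smul_rat W Cv]
  haveI : NeZero ((Cv • W).conductorNorm ℤ) := ⟨(WeierstrassCurve.conductorNorm_pos_holds (Cv • W)).ne'⟩
  have hN1 : (1 : ℝ) ≤ (((Cv • W).conductorNorm ℤ : ℕ) : ℝ) := by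
    exact_mod_cast WeierstrassCurve.conductorNorm_pos_holds (Cv • W)
  have hNpos : (0 : ℝ) < (((Cv • W).conductorNorm ℤ : ℕ) : ℝ) := by linarith
  have hlogN : 0 ≤ Real.log (((Cv • W).conductorNorm ℤ : ℕ) : ℝ) := Real.log_nonneg hN1
  have hεlog : 0 ≤ (1 / 2 + ε) * Real.log (((Cv • W).conductorNorm ℤ : ℕ) : ℝ) := by positivity
  by_cases hsmall : (Cv • W).conductorNorm ℤ < N₀
  · -- small conductor: Murty–Pasten's bound h_F < 0.1 N log N + 11 is a constant below N₀
    have hlt := Literature.NumberTheory.EllipticCurves.MurtyPasten.faltingsHeight_lt_of_modularity_mazurKenku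
      (fun V _ _ _ => hMod V) hMK (Cv • W)
    have hNle : (((Cv • W).conductorNorm ℤ : ℕ) : ℝ) ≤ (N₀ : ℝ) := by exact_mod_cast hsmall.le
    have hN₀1 : (1 : ℝ) ≤ (N₀ : ℝ) := hN1.trans hNle
    have hmono : 0.1 * (((Cv • W).conductorNorm ℤ : ℕ) : ℝ) * Real.log (((Cv • W).conductorNorm ℤ : ℕ) : ℝ)
        ≤ 0.1 * (N₀ : ℝ) * Real.log N₀ := by
      have hl : Real.log (((Cv • W).conductorNorm ℤ : ℕ) : ℝ) ≤ Real.log (N₀ : ℝ) := Real.log_le_log hNpos hNle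
      have hl0 : 0 ≤ Real.log (N₀ : ℝ) := Real.log_nonneg hN₀1
      nlinarith
    have hK : K₀ ≤ max K₀ K₁ := le_max_left _ _
    linarith
  · -- main case N ≥ N₀: the dictionary
    push Not at hsmall
    obtain ⟨D⟩ := hMod (Cv • W)
    obtain ⟨q, hq, hq4, hq5, hlp, hlm⟩ := hN₀ (Cv • W) ((Cv • W).conductorNorm ℤ) D rfl hsmall
    obtain ⟨hup, hum⟩ := hC₁ (Cv • W) ((Cv • W).conductorNorm ℤ) D rfl q hq hq4 hq5
    set x : ℝ := (((Cv • W).conductorNorm ℤ : ℕ) : ℝ) with hxdef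
    have hxpow : 0 < x ^ (2 * (1 / 2 + ε)) := Real.rpow_pos_of_pos hNpos _
    have hup' : (∑ a ∈ Finset.range q, (Literature.NumberTheory.EllipticCurves.ModularForms.normalizedPlusSymbol D.f ((a : ℚ) / q)) ^ 2)
        ≤ (C * x ^ (2 * (1 / 2 + ε))) * q :=
      hup.trans (by gcongr; exact le_max_left _ _)
    have hum' : (∑ a ∈ Finset.range q, (Literature.NumberTheory.EllipticCurves.ModularForms.normalizedMinusSymbol D.f ((a : ℚ) / q)) ^ 2)
        ≤ (C * x ^ (2 * (1 / 2 + ε))) * q :=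
      hum.trans (by gcongr; exact le_max_left _ _)
    have key := core (Cv • W) D q hq.pos (C * x ^ (2 * (1 / 2 + ε))) c (by positivity) hc hup' hum' hlp hlm
    have hcov_eq : ((Cv • W).baseChange ℂ).complexPeriod / 2 = ZLattice.covolume D.L.lattice := by
      have h2 := D.two_mul_covolume_eq_complexPeriod
      linarith
    rw [WeierstrassCurve.faltingsHeight_eq_neg_half_log, hcov_eq]
    have hden : 0 < 652 * (C * x ^ (2 * (1 / 2 + ε))) := by positivity
    have hcovge : c / (652 * (C * x ^ (2 * (1 / 2 + ε)))) ≤ ZLattice.covolume D.L.lattice := by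
      rw [div_le_iff₀ hden]; linarith [key]
    have hlog := Real.log_le_log (by positivity) hcovge
    rw [Real.log_div hc.ne' hden.ne', Real.log_mul (by norm_num) (by positivity),
      Real.log_mul hCpos.ne' hxpow.ne', Real.log_rpow hNpos] at hlog
    have hK : K₁ ≤ max K₀ K₁ := le_max_right _ _
    have hK₁' : K₁ = (1 / 2) * (Real.log 652 + Real.log C - Real.log c) := by
      rw [hK₁, Real.log_div (by positivity) hc.ne', Real.log_mul (by norm_num) hCpos.ne']
    linarith

end Summit.ABC.ABC.Theses.ParsevalSymbolDictionary
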